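import Summits.HodgeConjecture.HodgeConjecture.Theorems.PeriodDeficiencyQbarGenericIsHodgeGenericCore
import Summits.HodgeConjecture.HodgeConjecture.Theorems.PeriodDeficiencyQbarGenericIsHodgeGenericStubExistsMaximalAvoidingCountable
import Summits.HodgeConjecture.HodgeConjecture.Theorems.PeriodDeficiencyQbarGenericIsHodgeGenericStubIrreducibleSubsetOfCover
import Summits.HodgeConjecture.HodgeConjecture.Theorems.PeriodDeficiencyQbarGenericIsHodgeGenericStubCountableSpecialOfCover
import Literature.AlgebraicGeometry.Motives.SpecialSubvarietiesCountable
import HarnessLib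

/-!
# Crux `QbarGenericIsHodgeGeneric` (HGQ, stmt-HodgeConjecture-11595), line `registered`, reshape r5:
# the countability of special subvarieties from the Cattani–Deligne–Kaplan cover of the
# non-Hodge-generic loci

Helper file (`--supports stmt-HodgeConjecture-11595`) of the line lead c2. Reshape r4 of the line
skeleton (`Cruxes/QbarGenericIsHodgeGeneric/Lines/birth.lean`) closed the crux modulo its family-free
open core and ONE named fact, `Motives.countable_specialSubvarieties_meeting_affineOpen` ("the special
subvarieties of a smooth projective family meeting an affine open of the base are countably many",
Baldi–Klingler–Ullmo 2024 §3.4). Reshape r5 replaces that fact by the statement the literature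
actually PRINTS and proves the rest:

* the named fact `Motives.cdk1995_nonHodgeGenericLocus_countableCover` (appended to
  `Literature/AlgebraicGeometry/Motives/SpecialSubvarietiesCountable.lean`, p161402): **the non-Hodge-generic locus
  is a countable union of strict closed algebraic subvarieties** — Cattani–Deligne–Kaplan 1995
  Thm. 1.1 / Cor. 1.2 in the form of Baldi–Klingler–Ullmo 2024 Thm. 1.1 ("`HL(S, 𝕍^⊗)` is a
  countable union of closed irreducible algebraic subvarieties of `S`"), for the restriction of the
  variation to a closed irreducible, possibly singular, `Z ⊆ S` (BKU §3.2; through a resolution of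
  `Z`, Hironaka 1964) and André's description of the generic Mumford–Tate group (André 1992 §5:
  `MT(V_z) ⊆ G_Z` for all `z`, with equality off a countable union of strict subvarieties), traced
  on an affine chart `U` (the tree's bases are not assumed quasi-compact; cf. the docstring of
  `countable_specialSubvarieties_meeting_affineOpen`);
* the three LANDED stubs of reshape r5: countable prime avoidance in finitely generated
  `ℂ`-algebras (`Theorems.stub_exists_maximal_avoiding_countable`, p160542), its translation "an
  irreducible Zariski-closed set of complex points covered over an affine chart by countably many
  Zariski-closed sets lies in one of them" (`Theorems.stub_irreducible_subset_of_cover`, p160577), and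
  the descent "special subvarieties meeting an affine chart are countable, given countable
  strict-closed covers of the non-generic loci" (`Theorems.stub_countable_special_of_cover`, p160729).

Main results: `countable_special_chart_of_coverFact` — the chart countability consumed by
`Theorems.qbarGenericIsHodgeGeneric_of_rankInvariance_of_countable` (p156821), from the new fact;
`qbarGenericIsHodgeGeneric_of_coverFact_of_core` — **HGQ ⟸ (CDK cover fact) ∧ (family-free core)**;
`countable_specialSubvarieties_meeting_affineOpen_of_coverFact` — the r4 fact on every base with
bounded Mumford–Tate ranks (e.g. `S(ℂ)` path connected) is a COROLLARY of the new one.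

## References
* [CattaniDeligneKaplan1995JAMS] E. Cattani, P. Deligne, A. Kaplan, On the locus of Hodge classes,
  JAMS 8 (1995), Thm. 1.1, Cor. 1.2.
* [BaldiKlinglerUllmo2024] G. Baldi, B. Klingler, E. Ullmo, On the distribution of the Hodge locus,
  Invent. Math. 235 (2024), Thm. 1.1, §3.2, §3.4, Lemma 3.6.
* [Andre1992] Y. André, Mumford–Tate groups of mixed Hodge structures and the theorem of the fixed
  part, Compositio Math. 82 (1992), §5.
* [Hironaka1964] H. Hironaka, Resolution of singularities …, Ann. of Math. 79 (1964), Main Thm. I.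
* [KlinglerOtwinowskaUrbanik2023] B. Klingler, A. Otwinowska, D. Urbanik, Ann. Sci. ÉNS 56 (2023),
  §1.2, Conj. 1.5(a).
-/

noncomputable section

-- every declaration of this problem lives in `Summit.HodgeConjecture.HodgeConjecture.…` (problem = summit)
set_option linter.dupNamespace false

namespace Summit.HodgeConjecture.HodgeConjecture.Theorems

open CategoryTheory AlgebraicGeometry
open Literature.AlgebraicGeometry.Motives Literature.AlgebraicGeometry.HodgeTheory
open Summit.HodgeConjecture.HodgeConjecture.Theses.PeriodDeficiency (QbarGenericIsHodgeGeneric)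

/-! ### The chart countability from the cover fact -/

/-- **The special subvarieties of a smooth projective family meeting an affine open are countably
many, on every base with bounded Mumford–Tate ranks** — from the cover fact by the landed descent
(`stub_countable_special_of_cover`) and uncountability lemma
(`stub_irreducible_subset_of_cover ∘ stub_exists_maximal_avoiding_countable`). This is the statement
of the r4 residual fact `Motives.countable_specialSubvarieties_meeting_affineOpen` under the (always
honest) boundedness hypothesis, e.g. whenever `S(ℂ)` is path connected
(`mtRankAt_le_of_pathConnectedSpace`). [cite: BaldiKlinglerUllmo2024, §3.4 and Lemma 3.6] -/
theorem countable_specialSubvarieties_meeting_affineOpen_of_coverFact :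
    cdk1995_nonHodgeGenericLocus_countableCover → ∀ (B : BettiHodgeData ℂ), B.IsClassical →
      ∀ [HodgeTensorFacts.{0, 0}] ⦃𝒳 S : SchemeOver ℂ⦄ (f : 𝒳 ⟶ S) (n i : ℕ)
      (D : GeometricVHSData B f n i) [∀ s, Module.Finite ℚ (D.V.fiber s)],
      IrreducibleSpace S.left → AlgebraicGeometry.Smooth S.hom → ∀ (U : S.left.Opens), IsAffineOpen U →
      BddAbove (Set.range fun s : ComplexPoints S => D.mtRankAt s) →
      {Y : Set (ComplexPoints S) | D.IsSpecialSubvariety Y ∧ ∃ y ∈ Y, y.pt ∈ U}.Countable := by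
  intro hfact B hB _ 𝒳 S f n i D _ hirr hsm U hU hbdd
  haveI := hsm
  have hlft : LocallyOfFiniteType S.hom := inferInstance
  exact stub_countable_special_of_cover D.toVHSData hsm U hU hbdd
    (hfact B hB f n i D hirr hsm U hU)
    (stub_irreducible_subset_of_cover stub_exists_maximal_avoiding_countable hlft U hU)

/-- **The special subvarieties of a smooth projective family over a smooth irreducible base OF SOME
RELATIVE DIMENSION meeting an affine open are countably many** (given the cover fact): `S(ℂ)` is then
connected (`connectedSpace_complexPoints_of_irreducibleSpace`, SGA1 XII 2.4) and a topological manifold,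
hence path connected (`pathConnectedSpace_complexPoints_of_smoothOfRelativeDimension`), so the ranks are
bounded (`mtRankAt_le_of_pathConnectedSpace`). [cite: BaldiKlinglerUllmo2024, §3.4 and Lemma 3.6] -/
theorem countable_specialSubvarieties_meeting_affineOpen_of_coverFact_of_smoothOfRelativeDimension
    (hfact : cdk1995_nonHodgeGenericLocus_countableCover) (B : BettiHodgeData ℂ) (hB : B.IsClassical)
    [HodgeTensorFacts.{0, 0}] ⦃𝒳 S : SchemeOver ℂ⦄ (f : 𝒳 ⟶ S) (n i : ℕ) (D : GeometricVHSData B f n i)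
    [∀ s, Module.Finite ℚ (D.V.fiber s)] (hirr : IrreducibleSpace S.left) (m : ℕ)
    (hsm : SmoothOfRelativeDimension m S.hom) (U : S.left.Opens) (hU : IsAffineOpen U) :
    {Y : Set (ComplexPoints S) | D.IsSpecialSubvariety Y ∧ ∃ y ∈ Y, y.pt ∈ U}.Countable := by
  haveI := hsm
  haveI := hirr
  haveI hsm' : AlgebraicGeometry.Smooth S.hom := SmoothOfRelativeDimension.smooth m S.hom
  haveI : LocallyOfFiniteType S.hom := inferInstance
  haveI : ConnectedSpace (ComplexPoints S) := connectedSpace_complexPoints_of_irreducibleSpace S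
  haveI : PathConnectedSpace (ComplexPoints S) :=
    pathConnectedSpace_complexPoints_of_smoothOfRelativeDimension S m
  refine countable_specialSubvarieties_meeting_affineOpen_of_coverFact hfact B hB f n i D hirr hsm' U hU ?_
  rcases isEmpty_or_nonempty (ComplexPoints S) with h | ⟨⟨y₀⟩⟩
  · exact ⟨0, by rintro _ ⟨y, rfl⟩; exact (IsEmpty.false y).elim⟩
  · exact ⟨_, by rintro _ ⟨y, rfl⟩; exact mtRankAt_le_of_pathConnectedSpace D.toVHSData y₀ y⟩

/-- **The chart countability the crux consumes** (second hypothesis of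
`qbarGenericIsHodgeGeneric_of_rankInvariance_of_countable`, p156821), from the cover fact: for the
`ℚ̄`-family `f₀ ⊗_σ ℂ` over the smooth irreducible `S₀` and an affine open `U₀ ⊆ S₀`, the special
subvarieties of `S = S₀ ⊗_σ ℂ` meeting the affine chart `U₀ ⊗_σ ℂ` (`IsAffineOpen.preimage` along the
affine projection) are countably many — `S` is smooth (`smooth_baseChangeHom_hom`), irreducible
(`irreducibleSpace_baseChangeHom_left`), with bounded ranks (`stub_mtRankAt_bounded`, p147691).
[cite: BaldiKlinglerUllmo2024, §3.4 and Lemma 3.6] -/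
theorem countable_special_chart_of_coverFact :
    cdk1995_nonHodgeGenericLocus_countableCover → ∀ (B : BettiHodgeData ℂ), B.IsClassical →
      ∀ [HodgeTensorFacts.{0, 0}]
      (σ : AlgebraicClosure ℚ →+* ℂ) ⦃𝒳₀ S₀ : SchemeOver (AlgebraicClosure ℚ)⦄ (f₀ : 𝒳₀ ⟶ S₀)
      (n i : ℕ) (D : GeometricVHSData B ((baseChangeHom σ).map f₀) n i)
      [∀ s, Module.Finite ℚ (D.V.fiber s)],
      IrreducibleSpace S₀.left → AlgebraicGeometry.Smooth S₀.hom →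
      ∀ U₀ : S₀.left.Opens, IsAffineOpen U₀ →
        {Y : Set (ComplexPoints ((baseChangeHom σ).obj S₀)) | D.IsSpecialSubvariety Y ∧
          ∃ y ∈ Y, (baseChangeHomFst σ S₀).base y.pt ∈ U₀}.Countable := by
  intro hfact B hB _ σ 𝒳₀ S₀ f₀ n i D _ hirr hsm U₀ hU₀
  haveI := hirr
  haveI := hsm
  haveI : IrreducibleSpace ((baseChangeHom σ).obj S₀).left := irreducibleSpace_baseChangeHom_left σ
  haveI : IsAffineHom (baseChangeHomFst σ S₀) :=
    MorphismProperty.pullback_fst (P := @IsAffineHom) _ _ inferInstance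
  have hsm' : AlgebraicGeometry.Smooth ((baseChangeHom σ).obj S₀).hom := smooth_baseChangeHom_hom σ
  obtain ⟨C, hC⟩ := stub_mtRankAt_bounded B hB σ f₀ n i D hirr hsm
  exact countable_specialSubvarieties_meeting_affineOpen_of_coverFact hfact B hB
    ((baseChangeHom σ).map f₀) n i D inferInstance hsm' ((baseChangeHomFst σ S₀) ⁻¹ᵁ U₀)
    (hU₀.preimage _) ⟨C, by rintro _ ⟨y, rfl⟩; exact hC y⟩

/-! ### HGQ from the cover fact and the family-free core -/

/-- **HGQ ⟸ (Cattani–Deligne–Kaplan cover of the non-generic loci, named fact) ∧ (family-free core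
`dim MT(Hⁱ(X^τ)) = dim MT(Hⁱ(X))`)** — reshape r5 of the line `registered`: the countability debt of
`qbarGenericIsHodgeGeneric_of_core` (p157349) is now the printed CDK/BKU statement, everything between it
and the crux being proved (`countable_special_chart_of_coverFact`, `mtRankAt_conjPoint_of_core`,
`qbarGenericIsHodgeGeneric_of_rankInvariance_of_countable`). The second hypothesis is the open problem
(Klingler–Otwinowska–Urbanik 2023 Conj. 1.5(a) in family-free form; Deligne's absolute-Hodge territory),
kernel-proved equivalent to HGQ modulo known mathematics (`core_of_qbarGenericIsHodgeGeneric`).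
[cite: KlinglerOtwinowskaUrbanik2023, §1.2 and Conj. 1.5(a)] -/
theorem qbarGenericIsHodgeGeneric_of_coverFact_of_core :
    cdk1995_nonHodgeGenericLocus_countableCover →
    (∀ (B : BettiHodgeData ℂ), B.IsClassical → ∀ [HodgeTensorFacts.{0, 0}]
      (σ : AlgebraicClosure ℚ →+* ℂ) (τ : ringAutOver σ) ⦃n : ℕ⦄ ⦃X : SchemeOver ℂ⦄
      (hX : IsSmoothProjective n X) (i : ℕ) [Module.Finite ℚ (B.W.obj X i)]
      [Module.Finite ℚ (B.W.obj (conjugateVariety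
        (@AlgEquiv.toRingEquiv (AlgebraicClosure ℚ) ℂ ℂ _ _ _ σ.toAlgebra σ.toAlgebra τ) X) i)],
      (B.hodge (IsSmoothProjective.conjugateVariety_holds
        (@AlgEquiv.toRingEquiv (AlgebraicClosure ℚ) ℂ ℂ _ _ _ σ.toAlgebra σ.toAlgebra τ) hX) i).mtRank =
        (B.hodge hX i).mtRank) →
    QbarGenericIsHodgeGeneric := fun hfact hcore =>
  qbarGenericIsHodgeGeneric_of_rankInvariance_of_countable (mtRankAt_conjPoint_of_core hcore)
    (countable_special_chart_of_coverFact hfact)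

/-! ### The r4 residual fact is a theorem given the r5 fact (appended by the line lead c2) -/

/-- **`Motives.countable_specialSubvarieties_meeting_affineOpen` (the r4 residual named fact, p154148)
follows from `Motives.cdk1995_nonHodgeGenericLocus_countableCover` (the r5 one, p161402)** — in full
generality: a smooth morphism with irreducible source is smooth of some fixed relative dimension
(`Motives.exists_smoothOfRelativeDimension_of_smooth`, Görtz–Wedhorn I Prop. 6.15), so
`countable_specialSubvarieties_meeting_affineOpen_of_coverFact_of_smoothOfRelativeDimension` applies
(connected complex manifold `S(ℂ)` ⟹ bounded Mumford–Tate ranks ⟹ descent). Hence the tree's two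
named countability facts are ordered: discharging the cover fact discharges both.
[cite: BaldiKlinglerUllmo2024, Thm. 1.1, §3.4 and Lemma 3.6] -/
theorem countable_specialSubvarieties_meeting_affineOpen_of_coverFact_holds :
    cdk1995_nonHodgeGenericLocus_countableCover → countable_specialSubvarieties_meeting_affineOpen := by
  intro hfact B hB _ 𝒳 S f n i D _ hirr hsm U hU
  haveI := hirr
  haveI := hsm
  obtain ⟨m, hm⟩ := Literature.AlgebraicGeometry.Motives.exists_smoothOfRelativeDimension_of_smooth S.hom
  exact countable_specialSubvarieties_meeting_affineOpen_of_coverFact_of_smoothOfRelativeDimension hfact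
    B hB f n i D hirr m hm U hU

/-- **HGQ ⟸ (r5 cover fact) ∧ (family-free core), through the r4 interface**: the same conclusion as
`qbarGenericIsHodgeGeneric_of_coverFact_of_core`, obtained instead by feeding
`countable_specialSubvarieties_meeting_affineOpen_of_coverFact_holds` to the r4 composition
`qbarGenericIsHodgeGeneric_of_core` (p157349) — the two reshapes agree. [folklore] -/
theorem qbarGenericIsHodgeGeneric_of_coverFact_of_core' :
    cdk1995_nonHodgeGenericLocus_countableCover →
    (∀ (B : BettiHodgeData ℂ), B.IsClassical → ∀ [HodgeTensorFacts.{0, 0}]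
      (σ : AlgebraicClosure ℚ →+* ℂ) (τ : ringAutOver σ) ⦃n : ℕ⦄ ⦃X : SchemeOver ℂ⦄
      (hX : IsSmoothProjective n X) (i : ℕ) [Module.Finite ℚ (B.W.obj X i)]
      [Module.Finite ℚ (B.W.obj (conjugateVariety
        (@AlgEquiv.toRingEquiv (AlgebraicClosure ℚ) ℂ ℂ _ _ _ σ.toAlgebra σ.toAlgebra τ) X) i)],
      (B.hodge (IsSmoothProjective.conjugateVariety_holds
        (@AlgEquiv.toRingEquiv (AlgebraicClosure ℚ) ℂ ℂ _ _ _ σ.toAlgebra σ.toAlgebra τ) hX) i).mtRank =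
        (B.hodge hX i).mtRank) →
    QbarGenericIsHodgeGeneric := fun hfact hcore =>
  qbarGenericIsHodgeGeneric_of_core (countable_specialSubvarieties_meeting_affineOpen_of_coverFact_holds hfact)
    hcore

end Summit.HodgeConjecture.HodgeConjecture.Theorems

end
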